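import Summits.QuantumFields.YangMills.Theorems.LuscherReductionTwistedTraceScalingTubeBOPackage
import HarnessLib

/-!
# The COLOUR AVERAGE on tube functions: `tubeForm β (colourAvg f) = tubeForm β f` and `‖colourAvg f‖²_w ≤ ‖f‖²_w`
# (lane A of S-BASE, crux `TwistedTraceScaling` stmt-QuantumFields-20203, C4 INNER — the R32 repair in Lean; design note `pub/ym-fleet/ym-luscher-20007-p1/COARSE-DESIGN.md` §24)

cdisprove R32/R32b (`Negative/AvgKernelNoLabSlowFactor[Kinetic]`): the gauge-averaged kernel `K̃_β = avgKernel β` keeps the CONSTANT gauge mode, under which the slow variable of a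
tube point turns by `Ad`; so `K̃_β` has no LAB one-site slow factor, its slow factor is the `Ad`-averaged one-site kernel.  THIS FILE records the operator-level form of the
repair, which costs nothing: averaging a tube function over the constant gauge transformations (`colourAvg f (U) = ∫_{SU(2)} f(gUg⁻¹) dg`)
* leaves the tube form unchanged — ★★ `tubeForm_colourAvg : tubeForm β (colourAvg f) = tubeForm β f` (bi-invariance of `K̃_β` + invariance of the a-priori measure); and
* does not increase any colour-invariant weighted norm — ★ `tubeNormSq_colourAvg_le : tubeNormSq w (colourAvg f) ≤ tubeNormSq w f` (Jensen), for `w ≥ 0` bounded measurable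
  with `w(gUg⁻¹) = w(U)` (the record weight `N/χ` qualifies: `recordWeightRho_conj`, `gaugeAvg_gaugeTransform`).
Hence in the SLOW clause of `SoftTubeBOPackageAt` the slow test functions are WLOG colour invariant (`Ad`-invariant one-site amplitudes), on which the LAB one-site kernel
and its `Ad`-average coincide as quadratic forms; the spectral input is then `innerNoIntruderOneOrbitAt_one` (`…OneSiteInner`).  Engine: ★ `integral_colourAvg_mul_invariant`
(`∫ (colourAvg f)·F = ∫ f·F` for colour-invariant `F`; Fubini, as `integral_gaugeAvg_mul_invariant`).
HONEST FRAMING: exact symmetry bookkeeping for a stub of a child of the CONDITIONAL reduction route R2b1; no spectral claim; C4 OPEN; not a gap, not Clay.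
-/

set_option autoImplicit false

noncomputable section

open MeasureTheory Filter Topology Real
open scoped BigOperators
open Literature.MathematicalPhysics.QuantumFieldTheory
open Literature.MathematicalPhysics.QuantumLattice

namespace Summit.QuantumFields.YangMills.Theorems.FemtoTransferGap.TwoLattice.Avg

open Summit.QuantumFields.YangMills.Theorems.FemtoTransferGap

variable {L : ℕ} [NeZero L]

/-! ## §1 The colour average -/

/-- **Colour average** of a function of the links: `(colourAvg f)(U) = ∫_{SU(2)} f(gUg⁻¹) dg` (average over the CONSTANT gauge transformations). [cite: SeilerLNP1982, §2] -/
def colourAvg (f : GaugeConfig 3 L SU2 → ℝ) : GaugeConfig 3 L SU2 → ℝ :=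
  fun U => ∫ g, f (gaugeTransform (fun _ : Site 3 L => g) U) ∂haarProbability SU2

omit [NeZero L] in
/-- `(U, g) ↦ gUg⁻¹` is jointly measurable. [folklore] -/
theorem measurable_constGaugeAction : Measurable fun p : GaugeConfig 3 L SU2 × SU2 => gaugeTransform (fun _ : Site 3 L => p.2) p.1 := by
  refine measurable_pi_lambda _ fun e => ?_
  simp only [gaugeTransform]
  exact ((measurable_snd.mul ((measurable_pi_apply e).comp measurable_fst)).mul measurable_snd.inv)

omit [NeZero L] in
/-- `(U, g) ↦ φ(gUg⁻¹)` is jointly measurable for measurable `φ`. [folklore] -/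
theorem measurable_comp_constGaugeAction {φ : GaugeConfig 3 L SU2 → ℝ} (hφ : Measurable φ) :
    Measurable fun p : GaugeConfig 3 L SU2 × SU2 => φ (gaugeTransform (fun _ : Site 3 L => p.2) p.1) :=
  hφ.comp measurable_constGaugeAction

omit [NeZero L] in
/-- `g ↦ gUg⁻¹` is measurable. [folklore] -/
theorem measurable_constGaugeAction_left (U : GaugeConfig 3 L SU2) : Measurable fun g : SU2 => gaugeTransform (fun _ : Site 3 L => g) U := by
  refine measurable_pi_lambda _ fun e => ?_
  simp only [gaugeTransform]
  exact (measurable_id.mul measurable_const).mul measurable_id.inv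

omit [NeZero L] in
/-- `g ↦ φ(gUg⁻¹)` is measurable. [folklore] -/
theorem measurable_comp_constGaugeAction_left {φ : GaugeConfig 3 L SU2 → ℝ} (hφ : Measurable φ) (U : GaugeConfig 3 L SU2) :
    Measurable fun g : SU2 => φ (gaugeTransform (fun _ : Site 3 L => g) U) :=
  hφ.comp (measurable_constGaugeAction_left U)

omit [NeZero L] in
/-- `colourAvg φ` is measurable. [folklore] -/
theorem measurable_colourAvg {φ : GaugeConfig 3 L SU2 → ℝ} (hφ : Measurable φ) : Measurable (colourAvg φ) :=
  ((measurable_comp_constGaugeAction hφ).stronglyMeasurable.integral_prod_right' (ν := haarProbability SU2)).measurable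

omit [NeZero L] in
/-- Bounds pass through the colour average. [folklore] -/
theorem colourAvg_mem_Icc {φ : GaugeConfig 3 L SU2 → ℝ} (hφ : Measurable φ) {c C : ℝ} (hc : ∀ U, c ≤ φ U) (hC : ∀ U, φ U ≤ C) (U : GaugeConfig 3 L SU2) :
    c ≤ colourAvg φ U ∧ colourAvg φ U ≤ C := by
  have hm := measurable_comp_constGaugeAction_left hφ U
  have hint : Integrable (fun g : SU2 => φ (gaugeTransform (fun _ : Site 3 L => g) U)) (haarProbability SU2) :=
    integrable_of_measurable_abs_le _ hm (C := max |c| |C|) fun g => abs_le_max_abs_abs (hc _) (hC _)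
  have hc' : ∫ _g : SU2, c ∂haarProbability SU2 = c := by simp [integral_const]
  have hC' : ∫ _g : SU2, C ∂haarProbability SU2 = C := by simp [integral_const]
  unfold colourAvg
  constructor
  · have h := integral_mono (integrable_const c) hint fun g => hc (gaugeTransform (fun _ : Site 3 L => g) U)
    rwa [hc'] at h
  · have h := integral_mono hint (integrable_const C) fun g => hC (gaugeTransform (fun _ : Site 3 L => g) U)
    rwa [hC'] at h

omit [NeZero L] in
/-- `|colourAvg φ| ≤ C` when `|φ| ≤ C`. [folklore] -/
theorem abs_colourAvg_le {φ : GaugeConfig 3 L SU2 → ℝ} (hφ : Measurable φ) {C : ℝ} (hC : ∀ U, |φ U| ≤ C) (U : GaugeConfig 3 L SU2) :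
    |colourAvg φ U| ≤ C :=
  abs_le.mpr (colourAvg_mem_Icc hφ (fun U => (abs_le.mp (hC U)).1) (fun U => (abs_le.mp (hC U)).2) U)

omit [NeZero L] in
/-- Constant gauge transformations compose: `h(gUg⁻¹)h⁻¹ = (hg)U(hg)⁻¹`. [folklore] -/
theorem gaugeTransform_const_const (g h : SU2) (U : GaugeConfig 3 L SU2) :
    gaugeTransform (fun _ : Site 3 L => h) (gaugeTransform (fun _ : Site 3 L => g) U) = gaugeTransform (fun _ : Site 3 L => h * g) U := by
  rw [gaugeTransform_gaugeTransform]; rfl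

omit [NeZero L] in
/-- ★ The colour average is colour invariant. [folklore] -/
theorem colourAvg_conj (φ : GaugeConfig 3 L SU2 → ℝ) (c : SU2) (U : GaugeConfig 3 L SU2) :
    colourAvg φ (gaugeTransform (fun _ : Site 3 L => c) U) = colourAvg φ U := by
  unfold colourAvg
  simp only [gaugeTransform_const_const]
  exact integral_mul_right_eq_self (fun g : SU2 => φ (gaugeTransform (fun _ : Site 3 L => g) U)) c

omit [NeZero L] in
/-- The colour average of a colour-invariant function is the function. [folklore] -/
theorem colourAvg_of_invariant {φ : GaugeConfig 3 L SU2 → ℝ} (hφ : ∀ (c : SU2) (U : GaugeConfig 3 L SU2), φ (gaugeTransform (fun _ : Site 3 L => c) U) = φ U)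
    (U : GaugeConfig 3 L SU2) : colourAvg φ U = φ U := by
  unfold colourAvg
  simp only [hφ]
  simp [integral_const]

/-! ## §2 The Fubini engine and Jensen -/

/-- ★ **`∫ (colourAvg f)·F = ∫ f·F` for colour-invariant `F`** (both bounded measurable). [cite: SeilerLNP1982, §2] -/
theorem integral_colourAvg_mul_invariant {f F : GaugeConfig 3 L SU2 → ℝ} (hf : Measurable f) {Cf : ℝ} (hCf : ∀ U, |f U| ≤ Cf)
    (hF : Measurable F) {CF : ℝ} (hCF : ∀ U, |F U| ≤ CF) (hFinv : ∀ (c : SU2) (U : GaugeConfig 3 L SU2), F (gaugeTransform (fun _ : Site 3 L => c) U) = F U) :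
    ∫ U, colourAvg f U * F U ∂configMeasure SU2 L = ∫ U, f U * F U ∂configMeasure SU2 L := by
  have hJ : Measurable fun p : GaugeConfig 3 L SU2 × SU2 => f (gaugeTransform (fun _ : Site 3 L => p.2) p.1) * F (gaugeTransform (fun _ : Site 3 L => p.2) p.1) :=
    (measurable_comp_constGaugeAction hf).mul (measurable_comp_constGaugeAction hF)
  have hJb : ∀ p : GaugeConfig 3 L SU2 × SU2, |f (gaugeTransform (fun _ : Site 3 L => p.2) p.1) * F (gaugeTransform (fun _ : Site 3 L => p.2) p.1)| ≤ Cf * CF :=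
    fun p => by rw [abs_mul]; exact mul_le_mul (hCf _) (hCF _) (abs_nonneg _) ((abs_nonneg (f p.1)).trans (hCf p.1))
  have hint : Integrable (fun p : GaugeConfig 3 L SU2 × SU2 => f (gaugeTransform (fun _ : Site 3 L => p.2) p.1) * F (gaugeTransform (fun _ : Site 3 L => p.2) p.1))
      ((configMeasure SU2 L).prod (haarProbability SU2)) :=
    integrable_of_measurable_abs_le _ hJ hJb
  calc ∫ U, colourAvg f U * F U ∂configMeasure SU2 L
      = ∫ U, ∫ g, f (gaugeTransform (fun _ : Site 3 L => g) U) * F (gaugeTransform (fun _ : Site 3 L => g) U) ∂haarProbability SU2 ∂configMeasure SU2 L := by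
        refine integral_congr_ae (ae_of_all _ fun U => ?_)
        dsimp only
        unfold colourAvg
        rw [← integral_mul_const]
        refine integral_congr_ae (ae_of_all _ fun g => ?_)
        dsimp only
        rw [hFinv]
    _ = ∫ g, ∫ U, f (gaugeTransform (fun _ : Site 3 L => g) U) * F (gaugeTransform (fun _ : Site 3 L => g) U) ∂configMeasure SU2 L ∂haarProbability SU2 :=
        integral_integral_swap hint
    _ = ∫ g, ∫ U, f U * F U ∂configMeasure SU2 L ∂haarProbability SU2 := by
        refine integral_congr_ae (ae_of_all _ fun g => ?_)
        dsimp only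
        exact integral_comp_eq_of_measurePreserving (measurePreserving_gaugeTransform_configMeasure fun _ : Site 3 L => g)
          (F := fun W => f W * F W) (hf.mul hF)
    _ = ∫ U, f U * F U ∂configMeasure SU2 L := by simp [integral_const]

omit [NeZero L] in
/-- ★ Jensen: `(colourAvg f)² ≤ colourAvg (f²)` pointwise (bounded measurable `f`). [folklore] -/
theorem colourAvg_sq_le {f : GaugeConfig 3 L SU2 → ℝ} (hf : Measurable f) {C : ℝ} (hC : ∀ U, |f U| ≤ C) (U : GaugeConfig 3 L SU2) :
    colourAvg f U ^ 2 ≤ colourAvg (fun V => f V ^ 2) U := by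
  set h : SU2 → ℝ := fun g => f (gaugeTransform (fun _ : Site 3 L => g) U) with hh
  have hm : Measurable h := measurable_comp_constGaugeAction_left hf U
  have hC0 : 0 ≤ C := (abs_nonneg _).trans (hC U)
  have hb : ∀ g, |h g| ≤ C := fun g => hC _
  have hint : Integrable h (haarProbability SU2) := integrable_of_measurable_abs_le _ hm hb
  have hint2 : Integrable (fun g => h g ^ 2) (haarProbability SU2) :=
    integrable_of_measurable_abs_le _ (hm.pow_const 2) (C := C ^ 2) fun g => by
      rw [abs_pow]; exact pow_le_pow_left₀ (abs_nonneg _) (hb g) 2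
  set m : ℝ := ∫ g, h g ∂haarProbability SU2 with hmdef
  -- `0 ≤ ∫ (h − m)² = ∫ h² − m²`
  have hexp : ∫ g, (h g - m) ^ 2 ∂haarProbability SU2 = (∫ g, h g ^ 2 ∂haarProbability SU2) - m ^ 2 := by
    have e : (fun g => (h g - m) ^ 2) = fun g => h g ^ 2 - (2 * m) * h g + m ^ 2 := by funext g; ring
    rw [e, integral_add, integral_sub hint2 (hint.const_mul _), integral_const_mul]
    · simp [integral_const, ← hmdef]; ring
    · exact hint2.sub (hint.const_mul _)
    · exact integrable_const _
  have h0 : 0 ≤ ∫ g, (h g - m) ^ 2 ∂haarProbability SU2 := integral_nonneg fun g => sq_nonneg _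
  have : colourAvg f U = m := rfl
  rw [this]
  show m ^ 2 ≤ ∫ g, h g ^ 2 ∂haarProbability SU2
  linarith

/-! ## §3 ★ The weighted norm does not increase, ★★ the tube form is unchanged -/

/-- ★ **Jensen for the weighted norm**: `∫ (colourAvg f)²·w ≤ ∫ f²·w` for a colour-invariant weight `w ≥ 0` (all bounded measurable). [folklore] -/
theorem tubeNormSq_colourAvg_le {w f : GaugeConfig 3 L SU2 → ℝ} (hw : Measurable w) {Cw : ℝ} (hCw : ∀ U, |w U| ≤ Cw) (hw0 : ∀ U, 0 ≤ w U)
    (hwinv : ∀ (c : SU2) (U : GaugeConfig 3 L SU2), w (gaugeTransform (fun _ : Site 3 L => c) U) = w U)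
    (hf : Measurable f) {C : ℝ} (hC : ∀ U, |f U| ≤ C) :
    tubeNormSq w (colourAvg f) ≤ tubeNormSq w f := by
  unfold tubeNormSq
  have hC0 : 0 ≤ C := (abs_nonneg _).trans (hC 1)
  have hf2m : Measurable fun V => f V ^ 2 := hf.pow_const 2
  have hf2b : ∀ V, |f V ^ 2| ≤ C ^ 2 := fun V => by rw [abs_pow]; exact pow_le_pow_left₀ (abs_nonneg _) (hC V) 2
  have hstep : ∫ U, colourAvg (fun V => f V ^ 2) U * w U ∂configMeasure SU2 L = ∫ U, f U ^ 2 * w U ∂configMeasure SU2 L :=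
    integral_colourAvg_mul_invariant hf2m hf2b hw hCw hwinv
  rw [← hstep]
  refine integral_mono_of_nonneg (ae_of_all _ fun U => mul_nonneg (sq_nonneg _) (hw0 U)) ?_ (ae_of_all _ fun U => ?_)
  · exact integrable_of_measurable_abs_le _ ((measurable_colourAvg hf2m).mul hw) (C := C ^ 2 * Cw) fun U => by
      rw [abs_mul]; exact mul_le_mul (abs_colourAvg_le hf2m hf2b U) (hCw U) (abs_nonneg _) (sq_nonneg C)
  · exact mul_le_mul_of_nonneg_right (colourAvg_sq_le hf hC U) (hw0 U)

/-- The tube form as `∫ h(U)·(∫ K̃_β(U,V) h(V) dV) dU`. [folklore] -/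
theorem tubeForm_eq_integral_mul (β : ℝ) (h : GaugeConfig 3 L SU2 → ℝ) :
    tubeForm β h = ∫ U, h U * (∫ V, avgKernel β U V * h V ∂configMeasure SU2 L) ∂configMeasure SU2 L := by
  unfold tubeForm
  refine integral_congr_ae (ae_of_all _ fun U => ?_)
  dsimp only
  rw [← integral_const_mul]
  refine integral_congr_ae (ae_of_all _ fun V => ?_)
  dsimp only; ring

/-- The `V`-integral `∫ K̃_β(U,V) h(V) dV` is `gaugeAvg (K_β h)(U)`: measurable, bounded and GAUGE invariant in `U`. [cite: SeilerLNP1982, §3] -/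
theorem integral_avgKernel_mul_props (β : ℝ) {h : GaugeConfig 3 L SU2 → ℝ} (hh : Measurable h) {C : ℝ} (hC : ∀ U, |h U| ≤ C) :
    (Measurable fun U => ∫ V, avgKernel β U V * h V ∂configMeasure SU2 L) ∧
      (∃ M : ℝ, ∀ U, |∫ V, avgKernel β U V * h V ∂configMeasure SU2 L| ≤ M) ∧
      ∀ (g : Site 3 L → SU2) (U : GaugeConfig 3 L SU2),
        ∫ V, avgKernel β (gaugeTransform g U) V * h V ∂configMeasure SU2 L = ∫ V, avgKernel β U V * h V ∂configMeasure SU2 L := by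
  obtain ⟨M, hM0, hM⟩ := exists_avgKernel_le (L := L) β
  have hC0 : 0 ≤ C := (abs_nonneg _).trans (hC 1)
  refine ⟨?_, ⟨M * C, fun U => ?_⟩, fun g U => ?_⟩
  · have e : (fun U => ∫ V, avgKernel β U V * h V ∂configMeasure SU2 L) = gaugeAvg (transferApply β h) :=
      funext fun U => (gaugeAvg_transferApply_eq_integral_avgKernel β hh hC U).symm
    rw [e]
    exact measurable_gaugeAvg (measurable_transferApply β hh)
  · have h1 : |∫ V, avgKernel β U V * h V ∂configMeasure SU2 L| ≤ ∫ V, M * C ∂configMeasure SU2 L := by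
      refine (abs_integral_le_integral_abs).trans (integral_mono_of_nonneg (ae_of_all _ fun V => abs_nonneg _) (integrable_const _)
        (ae_of_all _ fun V => ?_))
      show |avgKernel β U V * h V| ≤ M * C
      rw [abs_mul, abs_of_pos (avgKernel_pos β U V)]
      exact mul_le_mul (hM U V) (hC V) (abs_nonneg _) hM0.le
    simpa [integral_const] using h1
  · simp_rw [avgKernel_gaugeTransform_left]

/-- ★★ **THE TUBE FORM IS BLIND TO THE COLOUR AVERAGE**: `tubeForm β (colourAvg f) = tubeForm β f` for bounded measurable `f` — the gauge-averaged kernel is bi-invariant, in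
particular under constant gauge transformations, and the a-priori measure is invariant. [cite: SeilerLNP1982, §3] -/
theorem tubeForm_colourAvg (β : ℝ) {f : GaugeConfig 3 L SU2 → ℝ} (hf : Measurable f) {C : ℝ} (hC : ∀ U, |f U| ≤ C) :
    tubeForm β (colourAvg f) = tubeForm β f := by
  have hSm := measurable_colourAvg hf
  have hSb := abs_colourAvg_le hf hC
  obtain ⟨M, hM0, hM⟩ := exists_avgKernel_le (L := L) β
  -- Step 1: the inner integrals agree, `∫ K̃(U,V) (colourAvg f)(V) dV = ∫ K̃(U,V) f(V) dV`
  have hinner : ∀ U, ∫ V, avgKernel β U V * colourAvg f V ∂configMeasure SU2 L = ∫ V, avgKernel β U V * f V ∂configMeasure SU2 L := fun U => by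
    have hKm := measurable_avgKernel_right β U
    have hKb : ∀ V, |avgKernel β U V| ≤ M := fun V => by rw [abs_of_pos (avgKernel_pos β U V)]; exact hM U V
    have hKinv : ∀ (c : SU2) (V : GaugeConfig 3 L SU2), avgKernel β U (gaugeTransform (fun _ : Site 3 L => c) V) = avgKernel β U V :=
      fun c V => avgKernel_gaugeTransform_right β _ U V
    have h1 := integral_colourAvg_mul_invariant hf hC hKm hKb hKinv
    simp_rw [mul_comm (avgKernel β U _)]
    exact h1
  -- Step 2: the outer integral, against the gauge-invariant `J(U) = ∫ K̃(U,V) f(V) dV`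
  obtain ⟨hJm, ⟨MJ, hJb⟩, hJinv⟩ := integral_avgKernel_mul_props β hf hC
  rw [tubeForm_eq_integral_mul, tubeForm_eq_integral_mul]
  simp_rw [hinner]
  exact integral_colourAvg_mul_invariant hf hC hJm hJb fun c U => hJinv (fun _ => c) U

omit [NeZero L] in
/-- ★ The colour average preserves support in a colour-invariant set: if `f` vanishes off `S` and `S` is colour invariant then so does `colourAvg f`. [folklore] -/
theorem colourAvg_eq_zero_of_support {f : GaugeConfig 3 L SU2 → ℝ} {S : Set (GaugeConfig 3 L SU2)}
    (hS : ∀ (c : SU2) (U : GaugeConfig 3 L SU2), gaugeTransform (fun _ : Site 3 L => c) U ∈ S ↔ U ∈ S) (hf : ∀ U, U ∉ S → f U = 0)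
    {U : GaugeConfig 3 L SU2} (hU : U ∉ S) : colourAvg f U = 0 := by
  unfold colourAvg
  have h : ∀ g : SU2, f (gaugeTransform (fun _ : Site 3 L => g) U) = 0 := fun g => hf _ (fun hmem => hU ((hS g U).mp hmem))
  simp [h]

end Summit.QuantumFields.YangMills.Theorems.FemtoTransferGap.TwoLattice.Avg

end
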